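import Summits.QuantumFields.YangMills.Theses.ModularSelfDualFold
import Literature.MathematicalPhysics.QuantumFieldTheory.WilsonTorusTransferMatrix

/-!
# Birth skeleton (BC3) for crux `WeakCouplingLatticeGap` (stmt-QuantumFields-8901) — `Lines/birth.lean`

Registrar: `planner-skel-stmt-QuantumFields-8901-0` (skeleton-register one-shot; route
`route-QuantumFields-ModularSelfDualFold`, re-audit bin REPAIRABLE), 2026-08-17.

Crux (route file `Theses/ModularSelfDualFold.lean`, decl
`Summit.QuantumFields.YangMills.Theses.ModularSelfDualFold.WeakCouplingLatticeGap`, "(L)"): for every compact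
SIMPLE `G` (`IsCompactSimpleLieGroup`) and every `r : LatticeRep G` there are `β₁` and a rate function `m`,
`m β > 0` on `[β₁, ∞)`, such that every pair of gauge-invariant local observables `A B : YMSpecies G` has
constants `C, S₀` UNIFORM IN `β ≥ β₁` with `|latticeConnectedCorr r.ρ β (2S+1) A.F B.F n| ≤ C·e^{−m(β) n}` for all
`S ≥ S₀`, `n ≤ S` — Wilson's four-dimensional theory is massive at every large bare coupling, volume-uniformly.

## The cut: at Lüscher's transfer matrix (the route's own interface `UniformGapBelowFold → (L)`)

The route header (TWO-LAYER PLAN) foresees `WeakCouplingLatticeGap ⇐ ModularSelfDuality → NoSelfDualMasslessBand →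
UniformGapBelowFold → WeakCouplingLatticeGap`, where the level-`k` machinery (K1–K3) OUTPUTS, after `k → ∞`, a
spectral gap of WILSON'S transfer matrix uniform in the spatial torus, which then passes "through the tree's
clustering ⇔ gap dictionary (`timeClustering_iff_massGap`, `latticeClustering_iff_gap`)" to (L).  The tree now HAS
Lüscher's transfer matrix `wilsonTorusTransferMatrix ρ β L` on `L²(G^{Edge 3 L}, ∏ Haar)` (compact, self-adjoint,
positive, positivity improving, with a Jentzsch gap at EACH `L` — `IsPositivityImproving.exists_spectralGap` — but
nothing uniform in `L`) and the cold-torus trace excess `traceExcess ρ β N m = Z_β(m × N³)/λ₊^m − 1`; its dictionary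
facts are stated for ONE infinite-volume measure and record "clustering uniform in the volume" as the missing
upgrade.  This skeleton therefore cuts (L) at the transfer matrix, into the three pieces every modular (or any
other Hamiltonian) proof of (L) must deliver, all `G`-uniform and typed over existing declarations:

* `stub_uniformTransferGap` (U, the heart; OPEN = the weak-coupling lattice gap in spectral form): for compact simple
  `G` and `r`, `∃ β₁ ∀ β ≥ β₁ ∃ Δ > 0 ∀ S`, the transfer matrix `𝕋 = wilsonTorusTransferMatrix r.ρ β (2S+1)` has a unit
  top eigenvector `φ` (`𝕋φ = ‖𝕋‖φ`) with `‖𝕋w‖ ≤ e^{−Δ}‖𝕋‖‖w‖` on `φ^⊥` — ONE rate `Δ(β)` for ALL spatial tori.  It is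
  the Wilson-side conclusion of the route's `UniformGapBelowFold` with the level quantifier `∀ k ≥ k₀(β)` already
  discharged (K3's `T_k(β) → T_Wilson(β)`); for `G = SU(2)` the level-`k` vocabulary it needs has landed
  (`ModularDatum`, `SU2LevelK`, `walkerWangTransfer`; refuter note 2026-08-16 on this item) — typing K1/K2 and the
  `--split` is the tenure planner's move, not this registrar's.
* `stub_coldTraceExcessDecay` (Θ, locality/entropy; the refuters' "C uniform in β and S needs locality, not only a
  gap"): at `β ≥ 0`, IF (U)'s gap holds at `β` THEN the thermal multiplicity of the cold torus is dilute —
  `∃ c > 0, C, S₁ ∀ S ≥ S₁ ∀ t, S ≤ 2(t+1) → traceExcess r.ρ β (2S+1) (t+1) ≤ C e^{−c(2(t+1) − S)}`: bounded at aspect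
  ratio `½`, exponentially small at the full period (a glueball gas `≈ (2S+1)³ e^{−Δ t}`; torelons `e^{−σ(2S+1)t}`).
* `stub_torusGapDictionary` (D, the volume-uniform torus dictionary): IF at every `β ≥ β₁` both (U)'s gap and (Θ)'s
  trace bound hold THEN the crux's conclusion for `(G, r)` — transfer-matrix calculus for slab insertions of local
  gauge-invariant observables on the `(2S+1)⁴` torus (`𝕋̂ᵏ = P₀ + Q_k`, `‖Q_k‖ ≤ e^{−Δk}`, `Tr Q_k = traceExcess`), the
  a-priori bound `2‖A‖∞‖B‖∞` for `n ≤` width and for `S < S₁(β)`, and the absorption of all `β`-dependence into the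
  free rate `m(β) ≤ min(Δ, c, 1/(2S₁(β)+2), …)` (the item's refuter notes, 2026-08-16 (2)).
* `WeakCouplingLatticeGap_of` — the composition, a real proof (registered form: the crux BY NAME, stubs used by name):
  fix `G, hG, r`; (U) gives `β₁`; apply (D) at `max β₁ 0` feeding, at each `β ≥ max β₁ 0`, the gap from (U) and the
  trace bound from (Θ) applied to that gap.  `weakCouplingLatticeGap_of_stubs` is the HYPOTHESIS FORM
  `<U-sig> → <Θ-sig> → <D-sig> → <crux body>` (sorry-free; axioms `propext`, `Classical.choice`, `Quot.sound`; the
  `example` after it instantiates it with the stubs AT the crux by name).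

No stub is the crux or the summit in costume: (U) and (Θ) are spectral statements about `𝕋` (no observables, no
correlations), (D) and (Θ) are implications with substantive antecedents; the cheap probes `stub → WeakCouplingLatticeGap`
and `stub → YangMills` fail for all three (registrar folder `bc/`, record in `Lines/birth.md`).

## Disproof used

None exists (`ledger crux ls stmt-QuantumFields-8901`: no workfiles before this one; no
`Theorems/WeakCouplingLatticeGap/Negative/`); the negatives index (5 entries, 2026-08-17) has no transfer-matrix /
clustering statement.  Junk audit by hand: `β = 0` (independent Haar links: `𝕋` = rank-one projection, `traceExcess = 0`)
satisfies (U)'s and (Θ)'s bodies and (D)'s conclusion — no degenerate refutation; negative `β` is excluded from (Θ) by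
`0 ≤ β` and is immaterial to (D) (its conclusion chooses its own `β₁`); `U(1)` and products are outside (U) by
`IsCompactSimpleLieGroup`, and make (Θ), (D) vacuous where their antecedents fail (Coulomb phase); finite-volume
uniqueness of `φ` is Jentzsch (tree), so (U) quantifies only the RATE.

Namespace `Summit.QuantumFields.YangMills.Cruxes.WeakCouplingLatticeGap.Birth`.
-/

noncomputable section

namespace Summit.QuantumFields.YangMills.Cruxes.WeakCouplingLatticeGap.Birth

open MeasureTheory
open Literature.MathematicalPhysics.QuantumFieldTheory
open Summit.QuantumFields.YangMills.Theses.ModularSelfDualFold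

/-- **Stub (U) — uniform transfer-matrix gap at weak coupling (OPEN; the crux's heart in spectral form).**  For every
compact simple `G` and every faithful unitary lattice representation `r` there is `β₁` such that at every `β ≥ β₁`
Lüscher's transfer matrix `𝕋 = wilsonTorusTransferMatrix r.ρ β (2S+1)` of Wilson's theory on the spatial torus
`(ℤ/(2S+1))³` has, for ONE `Δ = Δ(β) > 0` and ALL `S`, a unit top eigenvector `φ` with
`‖𝕋 w‖ ≤ e^{−Δ} ‖𝕋‖ ‖w‖` for all `w ⊥ φ` (spectrum of `𝕋/‖𝕋‖` in `{1} ∪ [0, e^{−Δ}]`, volume-uniformly). -/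
theorem stub_uniformTransferGap :
    open Literature.MathematicalPhysics.QuantumFieldTheory in
    ∀ (G : Type) [Group G] [TopologicalSpace G] [IsTopologicalGroup G] [CompactSpace G]
      [MeasurableSpace G] [BorelSpace G], IsCompactSimpleLieGroup G → ∀ r : LatticeRep G,
      ∃ β₁ : ℝ, ∀ β : ℝ, β₁ ≤ β →
        ∃ Δ : ℝ, 0 < Δ ∧ ∀ S : ℕ,
          ∃ φ : Lp ℝ 2 (Measure.pi fun _ : Edge 3 (2 * S + 1) => haarProbability G),
            ‖φ‖ = 1 ∧
            wilsonTorusTransferMatrix r.ρ β (2 * S + 1) φ =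
              ‖wilsonTorusTransferMatrix r.ρ β (2 * S + 1)‖ • φ ∧
            ∀ w : Lp ℝ 2 (Measure.pi fun _ : Edge 3 (2 * S + 1) => haarProbability G),
              inner ℝ φ w = 0 →
                ‖wilsonTorusTransferMatrix r.ρ β (2 * S + 1) w‖ ≤
                  Real.exp (-Δ) * ‖wilsonTorusTransferMatrix r.ρ β (2 * S + 1)‖ * ‖w‖ := by
  sorry

/-- **Stub (Θ) — dilute thermal multiplicity of the cold torus, given the gap (OPEN; locality/entropy).**  For every
compact `G`, `r`, and `β ≥ 0`: IF the transfer matrices `𝕋_{β,2S+1}` have a spectral gap `Δ > 0` uniform in `S` (the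
body of (U) at `β`) THEN there are `c > 0`, `C`, `S₁` such that for all `S ≥ S₁` and all time extents `t+1` at least
half the spatial side (`S ≤ 2(t+1)`), `traceExcess r.ρ β (2S+1) (t+1) = Σ_{i ≥ 1} (λᵢ/λ₊)^{t+1} ≤ C e^{−c (2(t+1) − S)}`. -/
theorem stub_coldTraceExcessDecay :
    open Literature.MathematicalPhysics.QuantumFieldTheory in
    ∀ (G : Type) [Group G] [TopologicalSpace G] [IsTopologicalGroup G] [CompactSpace G]
      [MeasurableSpace G] [BorelSpace G] (r : LatticeRep G) (β : ℝ), 0 ≤ β →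
      (∃ Δ : ℝ, 0 < Δ ∧ ∀ S : ℕ,
          ∃ φ : Lp ℝ 2 (Measure.pi fun _ : Edge 3 (2 * S + 1) => haarProbability G),
            ‖φ‖ = 1 ∧
            wilsonTorusTransferMatrix r.ρ β (2 * S + 1) φ =
              ‖wilsonTorusTransferMatrix r.ρ β (2 * S + 1)‖ • φ ∧
            ∀ w : Lp ℝ 2 (Measure.pi fun _ : Edge 3 (2 * S + 1) => haarProbability G),
              inner ℝ φ w = 0 →
                ‖wilsonTorusTransferMatrix r.ρ β (2 * S + 1) w‖ ≤
                  Real.exp (-Δ) * ‖wilsonTorusTransferMatrix r.ρ β (2 * S + 1)‖ * ‖w‖) →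
      ∃ c : ℝ, 0 < c ∧ ∃ (C : ℝ) (S₁ : ℕ), ∀ S : ℕ, S₁ ≤ S → ∀ t : ℕ, S ≤ 2 * t + 2 →
        traceExcess r.ρ β (2 * S + 1) (t + 1) ≤ C * Real.exp (-(c * (2 * (t : ℝ) + 2 - (S : ℝ)))) := by
  sorry

/-- **Stub (D) — the volume-uniform torus dictionary (OPEN; transfer-matrix calculus).**  For every compact `G`, `r`,
`β₁`: IF at every `β ≥ β₁` the transfer matrices have an `S`-uniform gap (body of (U)) AND the cold-torus trace excess
is dilute (conclusion of (Θ)), THEN the crux's conclusion holds for `(G, r)`: `∃ β₁' (m : ℝ → ℝ)`, `m β > 0` on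
`[β₁', ∞)`, and per pair `(A, B)` constants `C, S₀` uniform in `β ≥ β₁'` with
`|latticeConnectedCorr r.ρ β (2S+1) A.F B.F n| ≤ C e^{−m(β) n}` for all `S ≥ S₀`, `n ≤ S`. -/
theorem stub_torusGapDictionary :
    open Literature.MathematicalPhysics.QuantumFieldTheory in
    ∀ (G : Type) [Group G] [TopologicalSpace G] [IsTopologicalGroup G] [CompactSpace G]
      [MeasurableSpace G] [BorelSpace G] (r : LatticeRep G) (β₁ : ℝ),
      (∀ β : ℝ, β₁ ≤ β →
        (∃ Δ : ℝ, 0 < Δ ∧ ∀ S : ℕ,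
          ∃ φ : Lp ℝ 2 (Measure.pi fun _ : Edge 3 (2 * S + 1) => haarProbability G),
            ‖φ‖ = 1 ∧
            wilsonTorusTransferMatrix r.ρ β (2 * S + 1) φ =
              ‖wilsonTorusTransferMatrix r.ρ β (2 * S + 1)‖ • φ ∧
            ∀ w : Lp ℝ 2 (Measure.pi fun _ : Edge 3 (2 * S + 1) => haarProbability G),
              inner ℝ φ w = 0 →
                ‖wilsonTorusTransferMatrix r.ρ β (2 * S + 1) w‖ ≤
                  Real.exp (-Δ) * ‖wilsonTorusTransferMatrix r.ρ β (2 * S + 1)‖ * ‖w‖) ∧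
        (∃ c : ℝ, 0 < c ∧ ∃ (C : ℝ) (S₁ : ℕ), ∀ S : ℕ, S₁ ≤ S → ∀ t : ℕ, S ≤ 2 * t + 2 →
          traceExcess r.ρ β (2 * S + 1) (t + 1) ≤ C * Real.exp (-(c * (2 * (t : ℝ) + 2 - (S : ℝ)))))) →
      ∃ (β₁' : ℝ) (m : ℝ → ℝ), (∀ β : ℝ, β₁' ≤ β → 0 < m β) ∧ ∀ A B : YMSpecies G,
        ∃ (C : ℝ) (S₀ : ℕ), ∀ β : ℝ, β₁' ≤ β → ∀ S : ℕ, S₀ ≤ S → ∀ n : ℕ, n ≤ S →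
          |latticeConnectedCorr r.ρ β (2 * S + 1) A.F B.F n| ≤ C * Real.exp (-(m β * n)) := by
  sorry

/-- **Composition (registered form)**: the three stubs BY NAME give the crux BY NAME — fix `G`, `hG`, `r`; (U) gives
`β₁`; (D) at `max β₁ 0` applied to the family `β ↦ ⟨(U) at β, (Θ) at β on (U) at β⟩`.  The only `sorry`s of this file
are the three stubs. -/
theorem WeakCouplingLatticeGap_of :
    Summit.QuantumFields.YangMills.Theses.ModularSelfDualFold.WeakCouplingLatticeGap := by
  intro G _ _ _ _ _ _ hG r
  obtain ⟨β₁, hU⟩ := stub_uniformTransferGap G hG r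
  exact stub_torusGapDictionary G r (max β₁ 0) fun β hβ =>
    ⟨hU β ((le_max_left _ _).trans hβ),
      stub_coldTraceExcessDecay G r β ((le_max_right _ _).trans hβ) (hU β ((le_max_left _ _).trans hβ))⟩

/-- **Hypothesis form (BC3): `<stub (U) sig> → <stub (Θ) sig> → <stub (D) sig> → WeakCouplingLatticeGap`**, verbatim
signatures, NO reference to the stubs — a real, `sorry`-free proof (pure logic).  The conclusion is the crux's BODY
written out (definitionally the crux: see the `example` below), so that the skeleton audit, which takes the theorem
concluding the crux BY NAME, sees exactly one candidate, `WeakCouplingLatticeGap_of`. -/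
theorem weakCouplingLatticeGap_of_stubs
    (hU : ∀ (G : Type) [Group G] [TopologicalSpace G] [IsTopologicalGroup G] [CompactSpace G]
      [MeasurableSpace G] [BorelSpace G], IsCompactSimpleLieGroup G → ∀ r : LatticeRep G,
      ∃ β₁ : ℝ, ∀ β : ℝ, β₁ ≤ β →
        ∃ Δ : ℝ, 0 < Δ ∧ ∀ S : ℕ,
          ∃ φ : Lp ℝ 2 (Measure.pi fun _ : Edge 3 (2 * S + 1) => haarProbability G),
            ‖φ‖ = 1 ∧
            wilsonTorusTransferMatrix r.ρ β (2 * S + 1) φ =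
              ‖wilsonTorusTransferMatrix r.ρ β (2 * S + 1)‖ • φ ∧
            ∀ w : Lp ℝ 2 (Measure.pi fun _ : Edge 3 (2 * S + 1) => haarProbability G),
              inner ℝ φ w = 0 →
                ‖wilsonTorusTransferMatrix r.ρ β (2 * S + 1) w‖ ≤
                  Real.exp (-Δ) * ‖wilsonTorusTransferMatrix r.ρ β (2 * S + 1)‖ * ‖w‖)
    (hΘ : ∀ (G : Type) [Group G] [TopologicalSpace G] [IsTopologicalGroup G] [CompactSpace G]
      [MeasurableSpace G] [BorelSpace G] (r : LatticeRep G) (β : ℝ), 0 ≤ β →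
      (∃ Δ : ℝ, 0 < Δ ∧ ∀ S : ℕ,
          ∃ φ : Lp ℝ 2 (Measure.pi fun _ : Edge 3 (2 * S + 1) => haarProbability G),
            ‖φ‖ = 1 ∧
            wilsonTorusTransferMatrix r.ρ β (2 * S + 1) φ =
              ‖wilsonTorusTransferMatrix r.ρ β (2 * S + 1)‖ • φ ∧
            ∀ w : Lp ℝ 2 (Measure.pi fun _ : Edge 3 (2 * S + 1) => haarProbability G),
              inner ℝ φ w = 0 →
                ‖wilsonTorusTransferMatrix r.ρ β (2 * S + 1) w‖ ≤
                  Real.exp (-Δ) * ‖wilsonTorusTransferMatrix r.ρ β (2 * S + 1)‖ * ‖w‖) →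
      ∃ c : ℝ, 0 < c ∧ ∃ (C : ℝ) (S₁ : ℕ), ∀ S : ℕ, S₁ ≤ S → ∀ t : ℕ, S ≤ 2 * t + 2 →
        traceExcess r.ρ β (2 * S + 1) (t + 1) ≤ C * Real.exp (-(c * (2 * (t : ℝ) + 2 - (S : ℝ)))))
    (hD : ∀ (G : Type) [Group G] [TopologicalSpace G] [IsTopologicalGroup G] [CompactSpace G]
      [MeasurableSpace G] [BorelSpace G] (r : LatticeRep G) (β₁ : ℝ),
      (∀ β : ℝ, β₁ ≤ β →
        (∃ Δ : ℝ, 0 < Δ ∧ ∀ S : ℕ,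
          ∃ φ : Lp ℝ 2 (Measure.pi fun _ : Edge 3 (2 * S + 1) => haarProbability G),
            ‖φ‖ = 1 ∧
            wilsonTorusTransferMatrix r.ρ β (2 * S + 1) φ =
              ‖wilsonTorusTransferMatrix r.ρ β (2 * S + 1)‖ • φ ∧
            ∀ w : Lp ℝ 2 (Measure.pi fun _ : Edge 3 (2 * S + 1) => haarProbability G),
              inner ℝ φ w = 0 →
                ‖wilsonTorusTransferMatrix r.ρ β (2 * S + 1) w‖ ≤
                  Real.exp (-Δ) * ‖wilsonTorusTransferMatrix r.ρ β (2 * S + 1)‖ * ‖w‖) ∧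
        (∃ c : ℝ, 0 < c ∧ ∃ (C : ℝ) (S₁ : ℕ), ∀ S : ℕ, S₁ ≤ S → ∀ t : ℕ, S ≤ 2 * t + 2 →
          traceExcess r.ρ β (2 * S + 1) (t + 1) ≤ C * Real.exp (-(c * (2 * (t : ℝ) + 2 - (S : ℝ)))))) →
      ∃ (β₁' : ℝ) (m : ℝ → ℝ), (∀ β : ℝ, β₁' ≤ β → 0 < m β) ∧ ∀ A B : YMSpecies G,
        ∃ (C : ℝ) (S₀ : ℕ), ∀ β : ℝ, β₁' ≤ β → ∀ S : ℕ, S₀ ≤ S → ∀ n : ℕ, n ≤ S →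
          |latticeConnectedCorr r.ρ β (2 * S + 1) A.F B.F n| ≤ C * Real.exp (-(m β * n))) :
    ∀ (G : Type) [Group G] [TopologicalSpace G] [IsTopologicalGroup G] [CompactSpace G]
      [MeasurableSpace G] [BorelSpace G], IsCompactSimpleLieGroup G → ∀ r : LatticeRep G,
      ∃ (β₁ : ℝ) (m : ℝ → ℝ), (∀ β : ℝ, β₁ ≤ β → 0 < m β) ∧ ∀ A B : YMSpecies G,
        ∃ (C : ℝ) (S₀ : ℕ), ∀ β : ℝ, β₁ ≤ β → ∀ S : ℕ, S₀ ≤ S → ∀ n : ℕ, n ≤ S →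
          |latticeConnectedCorr r.ρ β (2 * S + 1) A.F B.F n| ≤ C * Real.exp (-(m β * n)) := by
  intro G _ _ _ _ _ _ hG r
  obtain ⟨β₁, hU'⟩ := hU G hG r
  exact hD G r (max β₁ 0) fun β hβ =>
    ⟨hU' β ((le_max_left _ _).trans hβ),
      hΘ G r β ((le_max_right _ _).trans hβ) (hU' β ((le_max_left _ _).trans hβ))⟩

/-- Signature match (kernel-checked): the stubs instantiate the hypothesis form, and its conclusion IS the crux by name
(definitional unfolding only). -/
example : Summit.QuantumFields.YangMills.Theses.ModularSelfDualFold.WeakCouplingLatticeGap :=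
  weakCouplingLatticeGap_of_stubs stub_uniformTransferGap stub_coldTraceExcessDecay stub_torusGapDictionary

#print axioms weakCouplingLatticeGap_of_stubs

end Summit.QuantumFields.YangMills.Cruxes.WeakCouplingLatticeGap.Birth

end
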